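import Summits.QuantumFields.BalabanUV.T4Continuum.Support.NE7LyapunovCellTable
import Summits.QuantumFields.BalabanUV.T4Continuum.Support.NE7LyapunovTorusBridge
import Summits.QuantumFields.BalabanUV.T4Continuum.Support.NE7StencilInverse
import HarnessLib

/-!
# NE7LyapunovIdentification — THE `d = 4` LYAPUNOV FORM `Q_P(f) = Σ_{x∈[0,P)⁴} Σ_{α∈{0,1,2}⁴} Π_μ c_{α_μ}‖D^α f(x)‖²` (`c = (1, 1∕4, 5∕8)`) OF THE LIFT'S MAIN PART, IDENTIFIED:
# `Q_{2N}(½·interp 2 (univ∖{κ}) φ) = ¼·(⊗_μ Fcell^{(κ)}_μ)(φ)` (cell table, summed), `Fcell ≈ A^{(κ)}` (regrouping), `(⊗_μ B_μ)(φ) = Q_N(B_c φ)`, hence the ONE-STEP LETTER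
# **`Q_{2N}((W∘B_c⁻¹ u)_κ) ≤ (3(17∕8)³∕4)·Q_N(u_κ) = 7.2·Q_N(u_κ)`**, `7.2 < 8 = L³` — the per-level growth of the Lyapunov mass of the exact lift's main part at `d = 4`, `L = 2`
# (lineage `b2b-balaban-t4-ne7b-p1`, gen 163; route (H′), memo `t4/b2b-balaban-t4-ne7b-p1/g162/records/SCOPING-LEVELMASSES.md` §11–§12, file (R3b) third part + (R3c) one step)

Cell `pub-balaban`, rung (B)+1 sub-cell t4, lineage `b2b-balaban-t4-ne7b-p1` (row NE7b OWNER + CRUX PROVER; junction service for row NE7 on ROAD-G116 §6 (G3) ∕ the ℓ² route to (G′)),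
generation 163.
WHY.  ✓ `NE7LyapunovCellTable.cell_table` gives the fine differences of the `M = 2` Whitney interpolant cell by cell; ✓ `NE7LyapunovTorusBridge` reads stencil-form inequalities on periodic
lattice fields; ✓ `NE7LyapunovTensor.lyapunov_tensor4_le` is the four-fold Lyapunov inequality `⊗A ≤ 3(17∕8)³·⊗B`; ✓ `NE7StencilInverse.interpCore_stencilInv` inverts the binomial stencil `B_c`
(`c = 1∕4` at `M = 2`).  THIS FILE sums the cell table over the cells of the period box (`[0,2N)⁴ = ⋃_y (2y + {0,1}⁴)`, ✓ `sum_blocks_eq`), regroups the cell forms into `Aflat`∕`Atent`,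
identifies `⊗_μ Bform_μ` with `Q∘B_c`, and concludes the one-step letter for the main part `W∘B_c⁻¹` of the exact lift of record ✓ `NE7WhitneyExactLiftFlat` (one component `κ` at a time;
the factor `½ = M⁻¹` of the lift included).
WHAT ([folklore]; DATA defs `cM`, `Mform`, `lyapQ`, `Bst`, `Fcell`, `cellIndexEquiv`; 0 sorry; `X` any real inner product space):
§1 `cM = (1, 1∕4, 5∕8)`, `Mform a j = (cM j, Dst a j)`, **`lyapQ P f := formEvalP P (Mform e₀ ⊗ Mform e₁ ⊗ Mform e₂ ⊗ Mform e₃) f`**; `formEvalP_prod4` (four-fold products as iterated sums of nested actions);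
§2 `sum_periodBox_two_mul` (cells), `cellIndexEquiv`, `cell_table'`, **`lyapQ_half_interp`**: `lyapQ (2N) (½•interp 2 (univ∖{κ}) φ) = ¼·formEvalP N (⊗_μ Fcell (cellT κ μ)) φ`;
§3 on any finite abelian group: `formEval_Fcell_tent` (`= formEval (Atent a)`), `formEval_Fcell_flat` (`= formEval (Aflat a)`), the product congruences `formEval_prod_congr_left∕right`, the transport
   `mapForm_Fcell_cellT`, and **`formEvalP_Fcell_le`**: `formEvalP N (⊗_μ Fcell (cellT κ μ)) φ ≤ 3(17∕8)³·formEvalP N (⊗ Bform e_μ) φ` for `N`-periodic `φ`;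
§4 `Bst = (b, ∇b, Δb)`, `act_Bst` (`= D ∘ b`), `interpCore_univ_quarter` (`B_{1∕4} = b₀b₁b₂b₃`), **`formEvalP_Bform_eq_lyapQ`**: `formEvalP N (⊗ Bform e_μ) φ = lyapQ N (B_{1∕4} φ)`;
§5 **`lyapQ_mainPart_step`**: for `N ≥ 1` and `N`-periodic `u`, `lyapQ (2N) (x ↦ ½ • interp 2 (univ∖{κ}) (stencilInv N ¼ u) x) ≤ (3·(17∕8)³∕4) · lyapQ N u`.
WHAT IS NOT HERE: the comparison `‖·‖² ≤ Q ≤ 12⁴‖·‖²`, the level iteration over composites, the gauge part of `r`, (C) in root form — next files.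
HONEST FRAMING (page 1): elementary lattice algebra about OUR lift; nothing of Bałaban's asserted; NOT (C), NOT (G3), NOT (G′), NOT NE7∕NE3 as spine nodes; row NE7b NOT PRINTED ∕ NOT PROVED;
spine 0∕9; finite T⁴ rung (B)+1 — NOT infinite volume, NOT mass gap, NOT BetaPertH, NOT Clay.
-/

set_option autoImplicit false

open scoped BigOperators RealInnerProductSpace
open Finset

namespace Summit.QuantumFields.BalabanUV.T4Continuum.NE7LyapunovIdentification

open Literature.MathematicalPhysics.QuantumFieldTheory.Balaban1983to89
open B7Prop1Explicit
open T4AveragingDeficitWallBoundary (periodBox mem_periodBox sum_blocks_eq blockSites_periodBox)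
open SmoothRefineInterp (interp interpCore interpCore_empty)
open NE7StencilForms (act conv formEval formProd act_conv act_comm act_smul formEval_prod_left formEval_prod_right formEval_nonneg)
open NE7LyapunovTensor (delta4 grad4 bst4 gradb4 lapb4 mid4 hgrad4 lapI4 Aflat Atent Bform Bform_nonneg act_delta4 act_grad4 act_bst4 act_gradb4 act_lapb4 lyapunov_tensor4_le)
open NE7LyapunovTorusBridge (formEvalP toTorus mapStencil mapForm redN_add redN_zero formEvalP_eq_formEval mapForm_formProd mapForm_Bform mapStencil_delta4 mapStencil_grad4 mapStencil_mid4
  mapStencil_hgrad4 mapStencil_lapI4)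
open NE7LyapunovCellTable (zero4 ngrad4 lap4 tentCell flatCell Dst cellT act_zero4 act_ngrad4 act_lap4 cell_table)
open NE7StencilInverse (stencil1 stencilInv interpCore_insert_stencil1 interpCore_stencilInv stencilInv_periodic)
open AveragingDeficitTorusChart (redN)

noncomputable section

variable {Γ : Type*} [AddCommGroup Γ]
variable {X : Type*} [NormedAddCommGroup X] [InnerProductSpace ℝ X]

/-! ## §1 The Lyapunov form and four-fold products as iterated sums -/

/-- The Lyapunov coefficients `c = (1, 1∕4, 5∕8)` (symbol `1 + ¼s + ⅝s²`, `s = 2 − 2cos θ`). [folklore] -/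
def cM : Fin 3 → ℝ := ![1, 1 / 4, 5 / 8]

/-- The coefficients are nonnegative. [folklore] -/
theorem cM_nonneg (j : Fin 3) : 0 ≤ cM j := by fin_cases j <;> norm_num [cM]

/-- **THE ONE-DIRECTION LYAPUNOV FORM** `M_a = (1, δ) + (¼, ∇_a) + (⅝, Δ_a)`. [folklore] -/
def Mform (a : Γ) : Fin 3 → ℝ × (Fin 4 → ℝ × Γ) := fun j => (cM j, Dst a j)

/-- **THE `d = 4` LYAPUNOV FORM ON `P`-PERIODIC LATTICE FIELDS**: `lyapQ P f = Σ_{x∈[0,P)⁴} Σ_α Π_μ c_{α_μ} ‖D^α f (x)‖²`, as the period-box evaluation of `⊗_μ M_{e_μ}`. [folklore] -/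
def lyapQ (P : ℕ) (f : Site 4 → X) : ℝ := formEvalP P (formProd (formProd (formProd (Mform (e 0)) (Mform (e 1))) (Mform (e 2))) (Mform (e 3))) f

section Prod4

variable {d : ℕ} {ι₀ ι₁ ι₂ ι₃ κ₀ κ₁ κ₂ κ₃ : Type*} [Fintype ι₀] [Fintype ι₁] [Fintype ι₂] [Fintype ι₃] [Fintype κ₀] [Fintype κ₁] [Fintype κ₂] [Fintype κ₃]

/-- **A FOUR-FOLD PRODUCT FORM AS AN ITERATED SUM OF NESTED ACTIONS.** [folklore] -/
theorem formEvalP_prod4 (P : ℕ) (F₀ : ι₀ → ℝ × (κ₀ → ℝ × Site d)) (F₁ : ι₁ → ℝ × (κ₁ → ℝ × Site d)) (F₂ : ι₂ → ℝ × (κ₂ → ℝ × Site d)) (F₃ : ι₃ → ℝ × (κ₃ → ℝ × Site d))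
    (v : Site d → X) :
    formEvalP P (formProd (formProd (formProd F₀ F₁) F₂) F₃) v
      = ∑ i₀, ∑ i₁, ∑ i₂, ∑ i₃, ((F₀ i₀).1 * (F₁ i₁).1 * (F₂ i₂).1 * (F₃ i₃).1)
          * ∑ x ∈ periodBox (d := d) P, ‖act (F₀ i₀).2 (act (F₁ i₁).2 (act (F₂ i₂).2 (act (F₃ i₃).2 v))) x‖ ^ 2 := by
  unfold formEvalP formProd
  rw [Fintype.sum_prod_type, Fintype.sum_prod_type, Fintype.sum_prod_type]
  simp only [act_conv]

end Prod4

/-! ## §2 Summing the cell table: `Q_{2N}` of the half interpolant -/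

/-- **THE CELLS OF THE FINE PERIOD BOX**: `Σ_{x∈[0,2P)⁴} g(x) = Σ_{y∈[0,P)⁴} Σ_{ρ∈{0,1}⁴} g(2y + ρ)`. [folklore] -/
theorem sum_periodBox_two_mul {d : ℕ} (P : ℕ) (g : Site d → ℝ) :
    ∑ x ∈ periodBox (d := d) (2 * P), g x = ∑ y ∈ periodBox (d := d) P, ∑ ρ : Fin d → Fin 2, g ((2 : ℤ) • y + boxVec 2 ρ) := by
  have h := sum_blocks_eq 2 (by norm_num) (periodBox (d := d) P) g
  rw [blockSites_periodBox 2 P (by norm_num)] at h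
  simp only [Nat.cast_ofNat] at h
  exact h.symm

/-- The re-indexing of the cell sum: `(α, ρ) ↦ ((α₀,ρ₀), (α₁,ρ₁), (α₂,ρ₂), (α₃,ρ₃))` (nested as the four-fold product forms are). [folklore] -/
def cellIndexEquiv : ((((Fin 3 × Fin 3) × Fin 3) × Fin 3) × (Fin 4 → Fin 2)) ≃ ((((Fin 3 × Fin 2) × (Fin 3 × Fin 2)) × (Fin 3 × Fin 2)) × (Fin 3 × Fin 2)) where
  toFun p := ((((p.1.1.1.1, p.2 0), (p.1.1.1.2, p.2 1)), (p.1.1.2, p.2 2)), (p.1.2, p.2 3))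
  invFun j := ((((j.1.1.1.1, j.1.1.2.1), j.1.2.1), j.2.1), ![j.1.1.1.2, j.1.1.2.2, j.1.2.2, j.2.2])
  left_inv p := by
    refine Prod.ext rfl ?_
    funext i
    fin_cases i <;> rfl
  right_inv j := by rfl

/-- **THE CELL FORM** of a one-direction table `T` (coefficient `c_a`, stencil `T a r` at index `(a, r)`). [folklore] -/
def Fcell (T : Fin 3 → Fin 2 → (Fin 4 → ℝ × Γ)) : Fin 3 × Fin 2 → ℝ × (Fin 4 → ℝ × Γ) := fun p => (cM p.1, T p.1 p.2)

/-- The cell table with separate multi-order entries. [folklore] -/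
theorem cell_table' (κ : Fin 4) (φ : Site 4 → X) (a₀ a₁ a₂ a₃ : Fin 3) (ρ : Fin 4 → Fin 2) (y : Site 4) :
    act (Dst (e 0) a₀) (act (Dst (e 1) a₁) (act (Dst (e 2) a₂) (act (Dst (e 3) a₃) (interp 2 (Finset.univ.erase κ) φ)))) ((2 : ℤ) • y + boxVec 2 ρ)
      = act (cellT κ 0 a₀ (ρ 0)) (act (cellT κ 1 a₁ (ρ 1)) (act (cellT κ 2 a₂ (ρ 2)) (act (cellT κ 3 a₃ (ρ 3)) φ))) y := by
  have h := cell_table κ φ ![a₀, a₁, a₂, a₃] ρ y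
  simp only [Matrix.cons_val_zero, Matrix.cons_val_one, Matrix.cons_val_two, Matrix.cons_val_three, Matrix.head_cons, Matrix.tail_cons] at h
  exact h

/-- `‖½ • z‖² = ¼‖z‖²`. [folklore] -/
theorem norm_half_smul_sq (z : X) : ‖(2 : ℝ)⁻¹ • z‖ ^ 2 = 4⁻¹ * ‖z‖ ^ 2 := by
  rw [norm_smul, norm_inv, Real.norm_ofNat, mul_pow]; norm_num

/-- **`Q_{2N}` OF THE HALF INTERPOLANT IS `¼` OF THE CELL FORM** (`d = 4`, `M = 2`, every `κ`, every coarse `φ`):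
`lyapQ (2N) (x ↦ ½ • interp 2 (univ∖{κ}) φ x) = ¼ · formEvalP N (Fcell (cellT κ 0) ⊗ Fcell (cellT κ 1) ⊗ Fcell (cellT κ 2) ⊗ Fcell (cellT κ 3)) φ`. [folklore] -/
theorem lyapQ_half_interp (N : ℕ) (κ : Fin 4) (φ : Site 4 → X) :
    lyapQ (2 * N) (fun x => (2 : ℝ)⁻¹ • interp 2 (Finset.univ.erase κ) φ x)
      = 4⁻¹ * formEvalP N (formProd (formProd (formProd (Fcell (cellT κ 0)) (Fcell (cellT κ 1))) (Fcell (cellT κ 2))) (Fcell (cellT κ 3))) φ := by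
  set F₀ : Site 4 → X := interp 2 (Finset.univ.erase κ) φ with hF₀
  -- the summand identity, cell by cell
  have hcell : ∀ (i : ((Fin 3 × Fin 3) × Fin 3) × Fin 3) (ρ : Fin 4 → Fin 2) (y : Site 4),
      ‖act (conv (conv (conv (Mform (e 0) i.1.1.1).2 (Mform (e 1) i.1.1.2).2) (Mform (e 2) i.1.2).2) (Mform (e 3) i.2).2) (fun x => (2 : ℝ)⁻¹ • F₀ x) ((2 : ℤ) • y + boxVec 2 ρ)‖ ^ 2
        = 4⁻¹ * ‖act (cellT κ 0 i.1.1.1 (ρ 0)) (act (cellT κ 1 i.1.1.2 (ρ 1)) (act (cellT κ 2 i.1.2 (ρ 2)) (act (cellT κ 3 i.2 (ρ 3)) φ))) y‖ ^ 2 := by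
    intro i ρ y
    simp only [Mform, act_conv, act_smul]
    rw [norm_half_smul_sq, hF₀, cell_table' κ φ i.1.1.1 i.1.1.2 i.1.2 i.2 ρ y]
  unfold lyapQ formEvalP
  calc ∑ i, (formProd (formProd (formProd (Mform (e 0)) (Mform (e 1))) (Mform (e 2))) (Mform (e 3)) i).1
          * ∑ x ∈ periodBox (d := 4) (2 * N), ‖act (formProd (formProd (formProd (Mform (e 0)) (Mform (e 1))) (Mform (e 2))) (Mform (e 3)) i).2 (fun x => (2 : ℝ)⁻¹ • F₀ x) x‖ ^ 2
      = ∑ i, ∑ ρ : Fin 4 → Fin 2, (formProd (formProd (formProd (Mform (e 0)) (Mform (e 1))) (Mform (e 2))) (Mform (e 3)) i).1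
          * (4⁻¹ * ∑ y ∈ periodBox (d := 4) N, ‖act (cellT κ 0 i.1.1.1 (ρ 0)) (act (cellT κ 1 i.1.1.2 (ρ 1)) (act (cellT κ 2 i.1.2 (ρ 2)) (act (cellT κ 3 i.2 (ρ 3)) φ))) y‖ ^ 2) := by
        refine Finset.sum_congr rfl fun i _ => ?_
        rw [sum_periodBox_two_mul, Finset.sum_comm, Finset.mul_sum]
        refine Finset.sum_congr rfl fun ρ _ => ?_
        congr 1
        rw [Finset.mul_sum]
        exact Finset.sum_congr rfl fun y _ => hcell i ρ y
    _ = ∑ p : ((((Fin 3 × Fin 3) × Fin 3) × Fin 3) × (Fin 4 → Fin 2)), (formProd (formProd (formProd (Mform (e 0)) (Mform (e 1))) (Mform (e 2))) (Mform (e 3)) p.1).1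
          * (4⁻¹ * ∑ y ∈ periodBox (d := 4) N, ‖act (cellT κ 0 p.1.1.1.1 (p.2 0)) (act (cellT κ 1 p.1.1.1.2 (p.2 1)) (act (cellT κ 2 p.1.1.2 (p.2 2)) (act (cellT κ 3 p.1.2 (p.2 3)) φ))) y‖ ^ 2) :=
        by symm; rw [Fintype.sum_prod_type]
    _ = ∑ j : ((((Fin 3 × Fin 2) × (Fin 3 × Fin 2)) × (Fin 3 × Fin 2)) × (Fin 3 × Fin 2)),
          (formProd (formProd (formProd (Fcell (cellT κ 0)) (Fcell (cellT κ 1))) (Fcell (cellT κ 2))) (Fcell (cellT κ 3)) j).1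
          * (4⁻¹ * ∑ y ∈ periodBox (d := 4) N, ‖act (formProd (formProd (formProd (Fcell (cellT κ 0)) (Fcell (cellT κ 1))) (Fcell (cellT κ 2))) (Fcell (cellT κ 3)) j).2 φ y‖ ^ 2) := by
        refine Fintype.sum_equiv cellIndexEquiv _ _ fun p => ?_
        simp only [cellIndexEquiv, Equiv.coe_fn_mk, formProd, Mform, Fcell, act_conv]
    _ = 4⁻¹ * ∑ j, (formProd (formProd (formProd (Fcell (cellT κ 0)) (Fcell (cellT κ 1))) (Fcell (cellT κ 2))) (Fcell (cellT κ 3)) j).1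
          * ∑ y ∈ periodBox (d := 4) N, ‖act (formProd (formProd (formProd (Fcell (cellT κ 0)) (Fcell (cellT κ 1))) (Fcell (cellT κ 2))) (Fcell (cellT κ 3)) j).2 φ y‖ ^ 2 := by
        rw [Finset.mul_sum]
        exact Finset.sum_congr rfl fun j _ => by ring

/-! ## §3 Regrouping the cell forms into `Aflat` ∕ `Atent`, and the four-fold inequality for the cell forms -/

section Regroup

variable [Fintype Γ]

/-- **THE TENT CELL FORM IS `Atent`, VALUE-WISE**: `formEval (Fcell (tentCell a)) w = formEval (Atent a) w`. [folklore] -/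
theorem formEval_Fcell_tent (a : Γ) (w : Γ → X) : formEval (Fcell (tentCell a)) w = formEval (Atent a) w := by
  simp only [formEval, Fcell, Atent, tentCell, Fintype.sum_prod_type, Fin.sum_univ_three, Fin.sum_univ_two, Fin.sum_univ_five, cM,
    Matrix.cons_val_zero, Matrix.cons_val_one, Matrix.cons_val_two, Matrix.cons_val_three, Matrix.cons_val_four, Matrix.head_cons, Matrix.tail_cons, act_zero4, norm_zero,
    zero_pow two_ne_zero, Finset.sum_const_zero]
  ring

/-- **THE FLAT CELL FORM IS `Aflat`, VALUE-WISE**: `formEval (Fcell (flatCell a)) w = formEval (Aflat a) w` (`‖−∇w‖ = ‖∇w‖`, regrouping `1+1 = 2`, `¼ + ⅝ + ⅝ = 3∕2`). [folklore] -/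
theorem formEval_Fcell_flat (a : Γ) (w : Γ → X) : formEval (Fcell (flatCell a)) w = formEval (Aflat a) w := by
  have hng : ∀ y, ‖act (ngrad4 a) w y‖ ^ 2 = ‖act (grad4 a) w y‖ ^ 2 := fun y => by
    rw [act_ngrad4, act_grad4, ← norm_neg, neg_sub]
  simp only [formEval, Fcell, Aflat, flatCell, Fintype.sum_prod_type, Fin.sum_univ_three, Fin.sum_univ_two, Fin.sum_univ_five, cM,
    Matrix.cons_val_zero, Matrix.cons_val_one, Matrix.cons_val_two, Matrix.cons_val_three, Matrix.cons_val_four, Matrix.head_cons, Matrix.tail_cons, act_zero4, norm_zero,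
    zero_pow two_ne_zero, Finset.sum_const_zero, hng, act_delta4]
  ring

variable {ι ι' κ κ' ιG κG : Type*} [Fintype ι] [Fintype ι'] [Fintype κ] [Fintype κ'] [Fintype ιG] [Fintype κG]

/-- Congruence of the product in the LEFT factor: value-wise equal left factors give value-wise equal products. [folklore] -/
theorem formEval_prod_congr_left (F : ι → ℝ × (κ → ℝ × Γ)) (G : ιG → ℝ × (κG → ℝ × Γ)) (F' : ι' → ℝ × (κ' → ℝ × Γ))
    (h : ∀ w : Γ → X, formEval F w = formEval G w) (v : Γ → X) : formEval (formProd F F') v = formEval (formProd G F') v := by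
  rw [formEval_prod_right, formEval_prod_right]
  exact Finset.sum_congr rfl fun i' _ => by rw [h]

/-- Congruence of the product in the RIGHT factor. [folklore] -/
theorem formEval_prod_congr_right (F : ι → ℝ × (κ → ℝ × Γ)) (F' : ι' → ℝ × (κ' → ℝ × Γ)) (G' : ιG → ℝ × (κG → ℝ × Γ))
    (h : ∀ w : Γ → X, formEval F' w = formEval G' w) (v : Γ → X) : formEval (formProd F F') v = formEval (formProd F G') v := by
  rw [formEval_prod_left, formEval_prod_left]
  exact Finset.sum_congr rfl fun i _ => by rw [h]

/-- The cell form of `if p then flat else tent`, value-wise, is `if p then Aflat else Atent`. [folklore] -/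
theorem formEval_Fcell_ite (p : Prop) [Decidable p] (a : Γ) (w : Γ → X) :
    formEval (Fcell (if p then flatCell a else tentCell a)) w = formEval (if p then Aflat a else Atent a) w := by
  split_ifs
  · exact formEval_Fcell_flat a w
  · exact formEval_Fcell_tent a w

end Regroup

section Transport

variable {d : ℕ} (N : ℕ) [NeZero N]

/-- `mapStencil N (zero4 a) = zero4 (redN N a)`. [folklore] -/
theorem mapStencil_zero4 (a : Site d) : mapStencil N (zero4 a) = zero4 (redN N a) := by
  funext k; fin_cases k <;> simp [mapStencil, zero4, redN_zero]
/-- `mapStencil N (ngrad4 a) = ngrad4 (redN N a)`. [folklore] -/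
theorem mapStencil_ngrad4 (a : Site d) : mapStencil N (ngrad4 a) = ngrad4 (redN N a) := by
  funext k; fin_cases k <;> simp [mapStencil, ngrad4, redN_zero]
/-- The tent table is transported to itself. [folklore] -/
theorem mapStencil_tentCell (a : Site d) (j : Fin 3) (r : Fin 2) : mapStencil N (tentCell a j r) = tentCell (redN N a) j r := by
  fin_cases j <;> fin_cases r <;>
    simp [tentCell, mapStencil_delta4, mapStencil_mid4, mapStencil_hgrad4, mapStencil_lapI4, mapStencil_zero4]
/-- The flat table is transported to itself. [folklore] -/
theorem mapStencil_flatCell (a : Site d) (j : Fin 3) (r : Fin 2) : mapStencil N (flatCell a j r) = flatCell (redN N a) j r := by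
  fin_cases j <;> fin_cases r <;>
    simp [flatCell, mapStencil_delta4, mapStencil_grad4, mapStencil_zero4, mapStencil_ngrad4]
/-- The cell form of the lift is transported to the cell form at the reduced step. [folklore] -/
theorem mapForm_Fcell_cellT (κ μ : Fin 4) :
    mapForm N (Fcell (cellT κ μ)) = Fcell (if μ = κ then flatCell (redN N (e μ)) else tentCell (redN N (e μ))) := by
  funext p
  unfold cellT
  split_ifs <;> simp [mapForm, Fcell, mapStencil_tentCell, mapStencil_flatCell]

end Transport

/-- **THE FOUR-FOLD INEQUALITY FOR THE CELL FORMS ON `N`-PERIODIC FIELDS** (`N ≥ 1`): `formEvalP N (⊗_μ Fcell (cellT κ μ)) φ ≤ 3·(17∕8)³ · formEvalP N (⊗_μ Bform e_μ) φ`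
— transport to the torus, regroup into `A`, ✓ `lyapunov_tensor4_le`, transport back. [folklore] -/
theorem formEvalP_Fcell_le {N : ℕ} (hN : 1 ≤ N) (κ : Fin 4) {φ : Site 4 → X} (hφ : ∀ (y : Site 4) (j : Fin 4), φ (y + (N : ℤ) • e j) = φ y) :
    formEvalP N (formProd (formProd (formProd (Fcell (cellT κ 0)) (Fcell (cellT κ 1))) (Fcell (cellT κ 2))) (Fcell (cellT κ 3))) φ
      ≤ (3 * (17 / 8 : ℝ) ^ 3) * formEvalP N (formProd (formProd (formProd (Bform (e (0 : Fin 4))) (Bform (e (1 : Fin 4)))) (Bform (e (2 : Fin 4)))) (Bform (e (3 : Fin 4)))) φ := by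
  haveI : NeZero N := ⟨by omega⟩
  rw [formEvalP_eq_formEval N _ hφ, formEvalP_eq_formEval N _ hφ]
  simp only [mapForm_formProd, mapForm_Fcell_cellT, mapForm_Bform]
  set a : Fin 4 → (Fin 4 → Fin N) := fun μ => redN N (e μ) with ha
  have hA : ∀ (μ : Fin 4) (w : (Fin 4 → Fin N) → X),
      formEval (Fcell (if μ = κ then flatCell (a μ) else tentCell (a μ))) w = formEval (if μ = κ then Aflat (a μ) else Atent (a μ)) w :=
    fun μ w => formEval_Fcell_ite _ _ w
  have h0123 : formEval (formProd (formProd (formProd (Fcell (if (0 : Fin 4) = κ then flatCell (a 0) else tentCell (a 0)))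
        (Fcell (if (1 : Fin 4) = κ then flatCell (a 1) else tentCell (a 1)))) (Fcell (if (2 : Fin 4) = κ then flatCell (a 2) else tentCell (a 2))))
        (Fcell (if (3 : Fin 4) = κ then flatCell (a 3) else tentCell (a 3)))) (toTorus N φ)
      = formEval (formProd (formProd (formProd (if (0 : Fin 4) = κ then Aflat (a 0) else Atent (a 0)) (if (1 : Fin 4) = κ then Aflat (a 1) else Atent (a 1)))
        (if (2 : Fin 4) = κ then Aflat (a 2) else Atent (a 2))) (if (3 : Fin 4) = κ then Aflat (a 3) else Atent (a 3))) (toTorus N φ) := by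
    rw [formEval_prod_congr_right _ _ _ (hA 3)]
    refine formEval_prod_congr_left _ _ _ (fun w => ?_) _
    rw [formEval_prod_congr_right _ _ _ (hA 2)]
    refine formEval_prod_congr_left _ _ _ (fun w' => ?_) _
    rw [formEval_prod_congr_right _ _ _ (hA 1)]
    exact formEval_prod_congr_left _ _ _ (hA 0) _
  rw [h0123]
  exact lyapunov_tensor4_le a κ (toTorus N φ)

/-! ## §4 The `B`-side: `⊗_μ Bform_μ = Q ∘ B_{1∕4}` -/

/-- The `B`-stencils `(b, ∇b, Δb)` of one direction. [folklore] -/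
def Bst (a : Γ) : Fin 3 → (Fin 4 → ℝ × Γ) := ![bst4 a, gradb4 a, lapb4 a]

/-- `Bform a j = (cM j, Bst a j)`. [folklore] -/
theorem Bform_eq (a : Γ) (j : Fin 3) : Bform a j = (cM j, Bst a j) := by
  fin_cases j <;> rfl

/-- **`B`-stencils are the `D`-stencils after `b`**: `act (Bst a j) v = act (Dst a j) (act (bst4 a) v)`. [folklore] -/
theorem act_Bst (a : Γ) (j : Fin 3) (v : Γ → X) : act (Bst a j) v = act (Dst a j) (act (bst4 a) v) := by
  funext y
  fin_cases j
  · simp [Bst, Dst, act_delta4]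
  · simp [Bst, Dst, act_gradb4, act_grad4]
  · simp only [Bst, Dst, Fin.reduceFinMk, Matrix.cons_val_two, Matrix.tail_cons, Matrix.head_cons, act_lapb4, act_lap4]

/-- `stencil1 i ¾ ¼ G = act (bst4 e_i) G`. [folklore] -/
theorem stencil1_quarter {d : ℕ} (i : Fin d) (G : Site d → X) : stencil1 i (1 - 1 / 4) (1 / 4) G = act (bst4 (e i)) G := by
  funext y; rw [act_bst4]; simp only [stencil1]; norm_num

/-- **`B_{1∕4} = b₀ b₁ b₂ b₃`**: `interpCore univ G y (const ¼) = act (bst4 e₀) (act (bst4 e₁) (act (bst4 e₂) (act (bst4 e₃) G))) y` (`d = 4`). [folklore] -/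
theorem interpCore_univ_quarter (G : Site 4 → X) (y : Site 4) :
    interpCore Finset.univ G y (fun _ => (1 / 4 : ℝ)) = act (bst4 (e 0)) (act (bst4 (e 1)) (act (bst4 (e 2)) (act (bst4 (e 3)) G))) y := by
  have hU : (Finset.univ : Finset (Fin 4)) = insert 3 (insert 2 (insert 1 (insert 0 ∅))) := by decide
  rw [hU, interpCore_insert_stencil1 (by decide), interpCore_insert_stencil1 (by decide), interpCore_insert_stencil1 (by decide), interpCore_insert_stencil1 (by decide),
    interpCore_empty, stencil1_quarter, stencil1_quarter, stencil1_quarter, stencil1_quarter]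

/-- **THE `B`-SIDE**: `formEvalP N (⊗_μ Bform e_μ) φ = lyapQ N (y ↦ interpCore univ φ y (const ¼))` (`d = 4`). [folklore] -/
theorem formEvalP_Bform_eq_lyapQ (N : ℕ) (φ : Site 4 → X) :
    formEvalP N (formProd (formProd (formProd (Bform (e (0 : Fin 4))) (Bform (e (1 : Fin 4)))) (Bform (e (2 : Fin 4)))) (Bform (e (3 : Fin 4)))) φ
      = lyapQ N (fun y => interpCore Finset.univ φ y (fun _ => (1 / 4 : ℝ))) := by
  have hB : (fun y => interpCore Finset.univ φ y (fun _ => (1 / 4 : ℝ))) = act (bst4 (e 0)) (act (bst4 (e 1)) (act (bst4 (e 2)) (act (bst4 (e 3)) φ))) := by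
    funext y; exact interpCore_univ_quarter φ y
  unfold lyapQ
  rw [hB, formEvalP_prod4, formEvalP_prod4]
  simp only [Bform_eq, Mform]
  refine Finset.sum_congr rfl fun j₀ _ => Finset.sum_congr rfl fun j₁ _ => Finset.sum_congr rfl fun j₂ _ => Finset.sum_congr rfl fun j₃ _ => ?_
  congr 1
  refine Finset.sum_congr rfl fun y _ => ?_
  -- `B₀(B₁(B₂(B₃ φ))) = D₀(D₁(D₂(D₃(b₀ b₁ b₂ b₃ φ))))`: write `B = D∘b` and commute the `b`'s inside
  rw [act_Bst, act_Bst, act_Bst, act_Bst]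
  rw [act_comm (bst4 (e 2)) (Dst (e 3) j₃), act_comm (bst4 (e 1)) (Dst (e 2) j₂), act_comm (bst4 (e 1)) (Dst (e 3) j₃),
    act_comm (bst4 (e 0)) (Dst (e 1) j₁), act_comm (bst4 (e 0)) (Dst (e 2) j₂), act_comm (bst4 (e 0)) (Dst (e 3) j₃)]

/-! ## §5 The one-step letter for the main part of the exact lift -/

/-- **THE ONE-STEP LYAPUNOV LETTER OF THE MAIN PART `W∘B_c⁻¹` AT `d = 4`, `M = L = 2`** (`N ≥ 1`, `u` an `N`-periodic coarse component):
`lyapQ (2N) (x ↦ ½ • interp 2 (univ∖{κ}) (stencilInv N ¼ u) x) ≤ (3·(17∕8)³∕4) · lyapQ N u` — the Lyapunov mass of the `κ`-component of the lift grows by at most `7.197 < 8 = L³` per level,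
uniformly in `N` and `κ`. [folklore] -/
theorem lyapQ_mainPart_step {N : ℕ} (hN : 1 ≤ N) (κ : Fin 4) {u : Site 4 → X} (hu : ∀ (y : Site 4) (j : Fin 4), u (y + (N : ℤ) • e j) = u y) :
    lyapQ (2 * N) (fun x => (2 : ℝ)⁻¹ • interp 2 (Finset.univ.erase κ) (stencilInv N (1 / 4 : ℝ) u) x) ≤ (3 * (17 / 8 : ℝ) ^ 3 / 4) * lyapQ N u := by
  set φ : Site 4 → X := stencilInv N (1 / 4 : ℝ) u with hφ
  have hφP : ∀ (y : Site 4) (j : Fin 4), φ (y + (N : ℤ) • e j) = φ y := fun y j => stencilInv_periodic N _ (fun x => hu x j) y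
  have hinv : (fun y => interpCore Finset.univ φ y (fun _ => (1 / 4 : ℝ))) = u := by
    funext y
    exact interpCore_stencilInv (by norm_num) (by norm_num) hN (fun j x => hu x j) y
  rw [lyapQ_half_interp N κ φ]
  have h := formEvalP_Fcell_le hN κ hφP
  rw [formEvalP_Bform_eq_lyapQ N φ, hinv] at h
  have hQ : 0 ≤ lyapQ N u := by
    unfold lyapQ
    exact NE7LyapunovTorusBridge.formEvalP_nonneg N _
      (fun j => mul_nonneg (mul_nonneg (mul_nonneg (cM_nonneg _) (cM_nonneg _)) (cM_nonneg _)) (cM_nonneg _)) u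
  nlinarith [h, hQ]

end

end Summit.QuantumFields.BalabanUV.T4Continuum.NE7LyapunovIdentification
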